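import Summits.QuantumFields.YangMills.Theorems.FluctuationComparisonRegPrIntLS2BetaPivotReadSmooth
import Literature.Analysis.Calculus.FixedPointSmoothDependence
import HarnessLib

/-!
# S2β · LAPLACE row — (C2-c): THE RE-SOLVED PIVOTS ARE `C^∞` ALONG A SMOOTH FAMILY (implicit-function assembly), AND (H1) `y ↦ A(Φ_V(σ y))` IS `C^∞` (pen w5-20520 g14)

Cell `ym3-torus` (rung R3: continuum `SU(2)` Yang–Mills on `T³` — NOT `d = 4`, NOT infinite volume, NOT a mass gap, NOT Clay); width seat `ym-ust-20520-w5` g14;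
helper of the crux `stmt-QuantumFields-20520` (`--supports`, NOT a proof of it).  THEOREMS ONLY (0 `def`, 0 `sorry`; default heartbeats); generic `(P, N)`.

WHY.  v8's displayed Peano row of the LAPLACE organ (w4-20520 g15) is `ContDiffAt ℝ 2 (fun y => wilsonAction4 (c.Φ (V, σ y))) 0`; px11 g10's LOCATE reduces it to (C2):
the window chart of record `Φ_V := c.Φ (V, ·)` (w3-20520 g14 ✓`exists_laplaceRows`) RE-SOLVES the pivots `βₙ` of the `n`-fold averaging in the environment `σ y`, so its
pivot log-coordinates `θ y := (c ↦ Λ(Φ_V(σ y)(βₙ c)·U₀(βₙ c)⁻¹))` are a CONTINUOUS family of zeros of the pivot-read `R(σ y, ·)` of ✓(C2-a)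
`…S2BetaPivotReadSmooth.contDiffAt_pivotRead`, which is `C^∞` at `(0,0)`; with (C2-b) — invertibility of its pivot-derivative, px11 g10, DISPLAYED here as the
hypothesis `hinv` — lit ✓`FixedPointSmoothDependence.contDiffAt_of_implicitZero'` makes `θ` smooth, hence `y ↦ ↑Φ_V(σ y)` smooth (§2), hence (H1) (§3, the Wilson
action is a polynomial in the bond matrices and their adjoints).

WHAT.  §1 letters: `extend` along the chart's own pivot values recovers the chart (`extend_pivots_eq_of_offPivot`), continuity of `Λ` inside the chart
(`continuousAt_logChart`), the ambient Wilson action `𝒜(V) = Σ_p (1 − Re Tr(V_a V_b V_c⋆ V_d⋆)∕N)` with `wilsonAction4 = 𝒜 ∘ coeField` and `ContDiff ℝ ⊤ 𝒜`.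
§2 ★★★ `contDiffAt_coeField_resolve`: rows (hoff) `Φ_V z` has `z`'s off-pivot coordinates on `Xc` · (hfib) `Ū⁽ⁿ⁾(Φ_V z) = Ū⁽ⁿ⁾ U₀` on `Xc` · (hΦc)
`ContinuousWithinAt Φ_V Xc U₀` · (hself) `Φ_V U₀ = U₀` · (hσX) `∀ᶠ y in 𝓝 0, σ y ∈ Xc` · the σ rows · the guard `SmallBelow n U₀` · (C2-b) `hinv` ⊢
`ContDiffAt ℝ ⊤ (fun y => coeField (Φ_V (σ y))) 0`.  §3 ★★★ (H1) `contDiffAt_wilsonAction4_resolve`: the same rows ⊢ `ContDiffAt ℝ ⊤ (fun y => wilsonAction4 (Φ_V (σ y))) 0`.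
§4 ★ `isInvertible_inr_of_blocks`: the raw `hinv` from the PER-BOND form px11 g10 types — `∂_X R(U₀,·)(0)` is block-diagonal over the coarse bonds
(✓`pivotRead_base_eq_chainMap`), so it is invertible as soon as every one-bond chart-read chain has invertible derivative at `0`.

HONEST SCOPE.  An implicit-function assembly over displayed chart rows; (C2-b) stays a hypothesis here; proves no stub; EXW ∕ GAP♯ ∕ DECAY ∕ LAPLACE ∕ S2β ∕ the crux 20520
NOT proved; `YM3TorusSU2` NOT proved; the Yang–Mills mass gap (Clay) NOT proved.

References: [Balaban1987RG1] CMP 109 (1987) (0.2) p. 252, (0.4) p. 253, p. 267 (after (2.10)); [Balaban1985Variational] CMP 102 (1985) (5) p. 278, Thm 1 (8)–(10) p. 279;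
[Dieudonne1960] Ch. X §2 (10.2.1)–(10.2.3); [Helgason2000] Ch. I §1 Thm 1.14 p. 96.
-/

noncomputable section

open scoped Matrix.Norms.L2Operator Topology ContDiff
open Filter Set Function
open Literature.MathematicalPhysics.QuantumFieldTheory.Balaban1983to89
open Literature.MathematicalPhysics.QuantumFieldTheory.Balaban1983to89.HaarExponentialChart
open Literature.MathematicalPhysics.QuantumFieldTheory.Balaban1983to89.HaarExponentialChart.IsChartRep
open Literature.MathematicalPhysics.QuantumFieldTheory.Balaban1983to89.BlockAveraging (Small Idx avgFun loopHol blockAvg blockAvg_avg)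
open Literature.MathematicalPhysics.QuantumFieldTheory.Balaban1983to89.ExpMeanLog (expMeanLogSU deltaSU)
open Literature.MathematicalPhysics.QuantumFieldTheory.Balaban1983to89.Node00
open Literature.MathematicalPhysics.QuantumLattice (fundamentalRep fundamentalRep_apply)
open MatrixLog (mlog analyticAt_mlog mlog_one)
open Literature.Analysis.Calculus (contDiffAt_of_implicitZero')
open Summit.QuantumFields.YangMills.BalabanUVNodes.N09ChartReadAveragingSmooth (contDiffAt_of_coe)
open Summit.QuantumFields.YangMills.Theorems.FluctuationComparisonRegPrIntLWregChain (iterCentralBond iterCentralBond_injective chainMap)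
open Summit.QuantumFields.YangMills.Theorems.FluctuationComparisonRegPrIntLS2BetaPivotReadSmooth

namespace Summit.QuantumFields.YangMills.Theorems.FluctuationComparisonRegPrIntLS2BetaPivotResolveSmooth

/-! ## §1 Letters: recovering the chart from its pivot values; `Λ` is continuous inside the chart; the ambient Wilson action -/

section Letters

variable {ι κ G : Type*}

/-- If `W` and `z` agree off the range of `β`, inserting `W`'s values at the pivots into `z` gives back `W`. [folklore] -/
theorem extend_pivots_eq_of_offPivot (β : κ → ι) {W z : ι → G} (h : ∀ b, (∀ c, β c ≠ b) → W b = z b) :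
    extend β (fun c => W (β c)) z = W := by
  classical
  funext b
  rw [Function.extend_def]
  split_ifs with hb
  · rw [Classical.choose_spec hb]
  · exact (h b fun c hc => hb ⟨c, hc⟩).symm

end Letters

section Chart

variable {N : ℕ} [NeZero N]

/-- **`Λ` IS CONTINUOUS INSIDE THE LOGARITHMIC CHART**: at every `g ∈ SU(N)` with `‖↑g − 1‖ < innerRadius`, the logarithmic chart of record is continuous (there it
reads `mlog`, analytic on `‖· − 1‖ < 1`; an `𝔰𝔲(N)`-valued map is continuous iff its matrix is). [cite: Helgason2000, Ch. I §1 Thm. 1.14 (13) p. 96] -/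
theorem continuousAt_logChart {g : SU N} (hg : ‖(g : Matrix (Fin N) (Fin N) ℂ) - 1‖ < innerRadius (specialUnitaryLogChart (Fin N))) :
    ContinuousAt (isChartRep_specialUnitaryGroup (n := Fin N)).logChart g := by
  set h := isChartRep_specialUnitaryGroup (n := Fin N) with hh
  rw [Topology.IsInducing.subtypeVal.continuousAt_iff]
  have hcont : Continuous fun g' : SU N => ‖((g' : SU N) : Matrix (Fin N) (Fin N) ℂ) - 1‖ :=
    continuous_norm.comp (continuous_subtype_val.sub continuous_const)
  have hopen : ∀ᶠ g' : SU N in 𝓝 g, ‖((g' : SU N) : Matrix (Fin N) (Fin N) ℂ) - 1‖ < innerRadius (specialUnitaryLogChart (Fin N)) :=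
    hcont.continuousAt.eventually (isOpen_Iio.mem_nhds hg)
  have heq : (fun g' : SU N => ((h.logChart g' : (specialUnitaryLogChart (Fin N)).lie) : Matrix (Fin N) (Fin N) ℂ)) =ᶠ[𝓝 g]
      fun g' : SU N => mlog (((g' : SU N) : Matrix (Fin N) (Fin N) ℂ)) := by
    filter_upwards [hopen] with g' hg'
    have hρ : ‖fundamentalRep (Fin N) g' - 1‖ < innerRadius (specialUnitaryLogChart (Fin N)) := by rw [fundamentalRep_apply]; exact hg'
    rw [h.coe_logChart hρ, fundamentalRep_apply]
  refine (ContinuousAt.congr ?_ heq.symm)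
  have h1 : ‖(g : Matrix (Fin N) (Fin N) ℂ) - 1‖ < 1 := lt_of_lt_of_le hg (le_trans innerRadius_le_half (by norm_num))
  exact (analyticAt_mlog h1).continuousAt.comp continuous_subtype_val.continuousAt

variable {P : Params} {j : ℕ}

/-- **THE WILSON ACTION READ ON THE BOND MATRICES**: `A(U) = Σ_p (1 − Re Tr(↑U_a·↑U_b·(↑U_c)⋆·(↑U_d)⋆)∕N)` (✓`coe_plaqHol_eq`, ✓`reTr_eq_traceLinearMap`).
[cite: Balaban1987RG1, (0.2) p.252] -/
theorem wilsonAction4_eq_ambient (U : GaugeField P j (SU N)) :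
    wilsonAction4 U = ∑ p : Plaq P j, (1 : ℝ) * (1 - ((Matrix.traceLinearMap (Fin N) ℝ ℂ)
      (coeField U ⟨p.src, p.μ⟩ * coeField U ⟨p.src.shift p.μ, p.ν⟩ * star (coeField U ⟨p.src.shift p.ν, p.μ⟩) * star (coeField U ⟨p.src, p.ν⟩))).re /
        (Fintype.card (Fin N) : ℝ)) := by
  unfold wilsonAction4 wilsonAction
  refine Finset.sum_congr rfl fun p _ => ?_
  rw [reTr_eq_traceLinearMap, coe_plaqHol_eq]
  rfl

omit [NeZero N] in
/-- **THE AMBIENT WILSON ACTION IS `C^∞`** (a finite sum of polynomials in the bond matrices and their adjoints, read through the continuous ℝ-linear `Re Tr ∕ N`).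
[cite: Balaban1987RG1, (0.2) p.252 (bookkeeping)] -/
theorem contDiff_ambientWilsonAction4 :
    ContDiff ℝ ⊤ fun V : PBond P j → Matrix (Fin N) (Fin N) ℂ => ∑ p : Plaq P j, (1 : ℝ) * (1 - ((Matrix.traceLinearMap (Fin N) ℝ ℂ)
      (V ⟨p.src, p.μ⟩ * V ⟨p.src.shift p.μ, p.ν⟩ * star (V ⟨p.src.shift p.ν, p.μ⟩) * star (V ⟨p.src, p.ν⟩))).re / (Fintype.card (Fin N) : ℝ)) := by
  have hev : ∀ b : PBond P j, ContDiff ℝ ⊤ (fun V : PBond P j → Matrix (Fin N) (Fin N) ℂ => V b) := fun b => contDiff_apply ℝ _ b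
  have hst : ∀ b : PBond P j, ContDiff ℝ ⊤ (fun V : PBond P j → Matrix (Fin N) (Fin N) ℂ => star (V b)) := fun b =>
    (starL' ℝ : Matrix (Fin N) (Fin N) ℂ ≃L[ℝ] Matrix (Fin N) (Fin N) ℂ).contDiff.comp (hev b)
  refine ContDiff.sum fun p _ => contDiff_const.mul (contDiff_const.sub (ContDiff.div_const ?_ _))
  have hprod : ContDiff ℝ ⊤ (fun V : PBond P j → Matrix (Fin N) (Fin N) ℂ =>
      V ⟨p.src, p.μ⟩ * V ⟨p.src.shift p.μ, p.ν⟩ * star (V ⟨p.src.shift p.ν, p.μ⟩) * star (V ⟨p.src, p.ν⟩)) :=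
    (((hev _).mul (hev _)).mul (hst _)).mul (hst _)
  have htr : ContDiff ℝ ⊤ (fun M : Matrix (Fin N) (Fin N) ℂ => ((Matrix.traceLinearMap (Fin N) ℝ ℂ) M).re) :=
    Complex.reCLM.contDiff.comp (LinearMap.toContinuousLinearMap (Matrix.traceLinearMap (Fin N) ℝ ℂ)).contDiff
  exact htr.comp hprod

/-- Hence along ANY family whose matrix field is `C^n` at a point, the Wilson action is `C^n` there. [cite: Balaban1985Variational, (5) p.278] -/
theorem contDiffAt_wilsonAction4_of_coeField {E : Type*} [NormedAddCommGroup E] [NormedSpace ℝ E] {m : WithTop ℕ∞}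
    {W : E → GaugeField P j (SU N)} {y₀ : E} (hW : ContDiffAt ℝ m (fun y => coeField (W y)) y₀) :
    ContDiffAt ℝ m (fun y => wilsonAction4 (W y)) y₀ := by
  have hfun : (fun y => wilsonAction4 (W y)) = (fun V : PBond P j → Matrix (Fin N) (Fin N) ℂ => ∑ p : Plaq P j, (1 : ℝ) * (1 - ((Matrix.traceLinearMap (Fin N) ℝ ℂ)
      (V ⟨p.src, p.μ⟩ * V ⟨p.src.shift p.μ, p.ν⟩ * star (V ⟨p.src.shift p.ν, p.μ⟩) * star (V ⟨p.src, p.ν⟩))).re / (Fintype.card (Fin N) : ℝ))) ∘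
        fun y => coeField (W y) := funext fun y => wilsonAction4_eq_ambient (W y)
  rw [hfun]
  exact (contDiff_ambientWilsonAction4.of_le le_top).contDiffAt.comp y₀ hW

end Chart

/-! ## §2 The re-solved pivots are `C^∞` along the family (implicit-function assembly) -/

section Resolve

variable {P : Params} {N : ℕ} [NeZero N]
variable {E : Type*} [NormedAddCommGroup E] [NormedSpace ℝ E] [CompleteSpace E]

/-- ★★★ **(C2-c) THE MATRIX FIELD OF THE RE-SOLVED CONFIGURATION IS `C^∞` ALONG THE FAMILY.**  Data: the guard `SmallBelow n U₀`; a continuous family `σ`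
through `σ 0 = U₀` with `C^∞` matrix field at `0`; a map `Φ_V` (the window chart at `V`, w3-20520 g14) and a set `Xc` (its carrier) with: `Φ_V z` agrees with `z` off
the pivots `βₙ` and `Ū⁽ⁿ⁾(Φ_V z) = Ū⁽ⁿ⁾ U₀` for `z ∈ Xc`, `Φ_V` continuous at `U₀` within `Xc`, `Φ_V U₀ = U₀`, and the transversal meets `Xc` near `0`; and (C2-b) —
invertibility of the pivot-derivative of the read (px11 g10), DISPLAYED as `hinv`.  Then `y ↦ ↑(Φ_V (σ y))` is `C^∞` at `0`: the pivot log-coordinates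
`θ y c := Λ(Φ_V(σ y)(βₙ c)·U₀(βₙ c)⁻¹)` are a continuous family of zeros of the `C^∞` pivot-read (✓(C2-a)), so lit ✓`contDiffAt_of_implicitZero'` makes `θ` smooth,
and `↑(Φ_V(σ y))` is the smooth ambient pivot field at `(y, θ y)` near `0`. [cite: Dieudonne1960, Ch. X §2 (10.2.1)–(10.2.3)] [cite: Balaban1987RG1, p.267 (after (2.10))] -/
theorem contDiffAt_coeField_resolve {n : ℕ} (U₀ : GaugeField P 0 (SU N))
    (hU₀ : SmallBelow (fun j => blockAvg (P := P) (j := j) (expMeanLogSU (n := Fin N))) n U₀)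
    (σ : E → GaugeField P 0 (SU N)) (hσc : Continuous σ) (hσ0 : σ 0 = U₀) (hσs : ContDiffAt ℝ ⊤ (fun y => coeField (σ y)) 0)
    (Φ : GaugeField P 0 (SU N) → GaugeField P 0 (SU N)) (Xc : Set (GaugeField P 0 (SU N)))
    (hoff : ∀ z ∈ Xc, ∀ b, (∀ c, iterCentralBond n c ≠ b) → Φ z b = z b)
    (hfib : ∀ z ∈ Xc, Averaging.iter (fun j => blockAvg (P := P) (j := j) (expMeanLogSU (n := Fin N))) n (Φ z) =
      Averaging.iter (fun j => blockAvg (P := P) (j := j) (expMeanLogSU (n := Fin N))) n U₀)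
    (hΦc : ContinuousWithinAt Φ Xc U₀) (hself : Φ U₀ = U₀) (hσX : ∀ᶠ y in 𝓝 0, σ y ∈ Xc)
    (hinv : ((fderiv ℝ (fun p : E × (PBond P n → (specialUnitaryLogChart (Fin N)).lie) => fun c : PBond P n =>
        (isChartRep_specialUnitaryGroup (n := Fin N)).logChart
          (Averaging.iter (fun j => blockAvg (P := P) (j := j) (expMeanLogSU (n := Fin N))) n
              (extend (iterCentralBond n) (fun c' => (isChartRep_specialUnitaryGroup (n := Fin N)).expChart (p.2 c') * U₀ (iterCentralBond n c')) (σ p.1)) c *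
            (Averaging.iter (fun j => blockAvg (P := P) (j := j) (expMeanLogSU (n := Fin N))) n U₀ c)⁻¹)) (0, 0)).comp
        (ContinuousLinearMap.inr ℝ E (PBond P n → (specialUnitaryLogChart (Fin N)).lie))).IsInvertible) :
    ContDiffAt ℝ ⊤ (fun y => coeField (Φ (σ y))) 0 := by
  classical
  haveI : CompleteSpace (specialUnitaryLogChart (Fin N)).lie := FiniteDimensional.complete ℝ _
  set h := isChartRep_specialUnitaryGroup (n := Fin N) with hh
  -- the pivot-read along the family and the pivot log-coordinates of the re-solved configuration
  set R : E × (PBond P n → (specialUnitaryLogChart (Fin N)).lie) → PBond P n → (specialUnitaryLogChart (Fin N)).lie :=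
    fun p c => h.logChart (Averaging.iter (fun j => blockAvg (P := P) (j := j) (expMeanLogSU (n := Fin N))) n
      (extend (iterCentralBond n) (fun c' => h.expChart (p.2 c') * U₀ (iterCentralBond n c')) (σ p.1)) c *
        (Averaging.iter (fun j => blockAvg (P := P) (j := j) (expMeanLogSU (n := Fin N))) n U₀ c)⁻¹) with hR
  set θ : E → PBond P n → (specialUnitaryLogChart (Fin N)).lie :=
    fun y c => h.logChart (Φ (σ y) (iterCentralBond n c) * (U₀ (iterCentralBond n c))⁻¹) with hθ
  -- `θ 0 = 0`
  have hθ0 : θ 0 = 0 := by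
    funext c
    show h.logChart (Φ (σ 0) (iterCentralBond n c) * (U₀ (iterCentralBond n c))⁻¹) = 0
    rw [hσ0, hself, mul_inv_cancel, h.logChart_one]
  -- `Φ ∘ σ → U₀` at `0`
  have hΦσ : Tendsto (fun y => Φ (σ y)) (𝓝 0) (𝓝 U₀) := by
    have hσW : Tendsto σ (𝓝 (0 : E)) (𝓝[Xc] U₀) :=
      tendsto_nhdsWithin_iff.2 ⟨by rw [← hσ0]; exact hσc.continuousAt, hσX⟩
    have := hΦc.tendsto.comp hσW
    rwa [hself] at this
  -- the relative pivot values tend to `1`, so they stay inside the chart, and `θ` is continuous at `0`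
  have hrel : ∀ c, Tendsto (fun y => Φ (σ y) (iterCentralBond n c) * (U₀ (iterCentralBond n c))⁻¹) (𝓝 0) (𝓝 1) := by
    intro c
    have h1 : Tendsto (fun y => Φ (σ y) (iterCentralBond n c)) (𝓝 0) (𝓝 (U₀ (iterCentralBond n c))) :=
      ((continuous_apply (iterCentralBond n c)).tendsto U₀).comp hΦσ
    have h2 := h1.mul (tendsto_const_nhds (x := (U₀ (iterCentralBond n c))⁻¹))
    rwa [mul_inv_cancel] at h2
  have hin : ∀ c, ∀ᶠ y in 𝓝 (0 : E), ‖((Φ (σ y) (iterCentralBond n c) * (U₀ (iterCentralBond n c))⁻¹ : SU N) : Matrix (Fin N) (Fin N) ℂ) - 1‖ <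
      innerRadius (specialUnitaryLogChart (Fin N)) := by
    intro c
    have hcont : Continuous fun g' : SU N => ‖((g' : SU N) : Matrix (Fin N) (Fin N) ℂ) - 1‖ :=
      continuous_norm.comp (continuous_subtype_val.sub continuous_const)
    have hc : Tendsto (fun y => ‖((Φ (σ y) (iterCentralBond n c) * (U₀ (iterCentralBond n c))⁻¹ : SU N) : Matrix (Fin N) (Fin N) ℂ) - 1‖) (𝓝 0) (𝓝 0) := by
      have h1 : ‖((1 : SU N) : Matrix (Fin N) (Fin N) ℂ) - 1‖ = 0 := by rw [OneMemClass.coe_one, sub_self, norm_zero]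
      have := (hcont.tendsto (1 : SU N)).comp (hrel c)
      rw [h1] at this
      exact this
    exact (hc.eventually (gt_mem_nhds innerRadius_pos))
  have hθc : ContinuousAt θ 0 := by
    refine continuousAt_pi.2 fun c => ?_
    have h1 : ContinuousAt h.logChart (1 : SU N) := continuousAt_logChart (by rw [OneMemClass.coe_one, sub_self, norm_zero]; exact innerRadius_pos)
    have h0 : Φ (σ 0) (iterCentralBond n c) * (U₀ (iterCentralBond n c))⁻¹ = 1 := by rw [hσ0, hself, mul_inv_cancel]
    have h2 : ContinuousAt (fun y => Φ (σ y) (iterCentralBond n c) * (U₀ (iterCentralBond n c))⁻¹) 0 := by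
      rw [ContinuousAt, h0]; exact hrel c
    exact ContinuousAt.comp_of_eq h1 h2 h0
  -- `θ` is a family of zeros of the read: inserting `Θ(θ y)·U₀∘βₙ` into `σ y` gives back `Φ (σ y)`, which averages to `Ū⁽ⁿ⁾ U₀`
  have hins : ∀ᶠ y in 𝓝 (0 : E),
      extend (iterCentralBond n) (fun c' => h.expChart (θ y c') * U₀ (iterCentralBond n c')) (σ y) = Φ (σ y) := by
    filter_upwards [hσX, Filter.eventually_all.2 hin] with y hyX hyin
    have hval : (fun c' => h.expChart (θ y c') * U₀ (iterCentralBond n c')) = fun c' => Φ (σ y) (iterCentralBond n c') := by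
      funext c'
      have hρ : ‖fundamentalRep (Fin N) (Φ (σ y) (iterCentralBond n c') * (U₀ (iterCentralBond n c'))⁻¹) - 1‖ <
          innerRadius (specialUnitaryLogChart (Fin N)) := by rw [fundamentalRep_apply]; exact hyin c'
      show h.expChart (h.logChart (Φ (σ y) (iterCentralBond n c') * (U₀ (iterCentralBond n c'))⁻¹)) * U₀ (iterCentralBond n c') = _
      rw [h.expChart_logChart hρ, inv_mul_cancel_right]
    rw [hval]
    exact extend_pivots_eq_of_offPivot (iterCentralBond n) (hoff (σ y) hyX)
  have hzero : ∀ᶠ y in 𝓝 (0 : E), R (y, θ y) = R (0, θ 0) := by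
    have hR0 : R (0, θ 0) = 0 := by
      funext c
      show h.logChart (Averaging.iter (fun j => blockAvg (P := P) (j := j) (expMeanLogSU (n := Fin N))) n
        (extend (iterCentralBond n) (fun c' => h.expChart (θ 0 c') * U₀ (iterCentralBond n c')) (σ 0)) c *
          (Averaging.iter (fun j => blockAvg (P := P) (j := j) (expMeanLogSU (n := Fin N))) n U₀ c)⁻¹) = 0
      rw [hθ0, hσ0]
      exact pivotRead_base_zero U₀ c
    rw [hR0]
    filter_upwards [hins, hσX] with y hy hyX
    funext c
    show h.logChart (Averaging.iter (fun j => blockAvg (P := P) (j := j) (expMeanLogSU (n := Fin N))) n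
      (extend (iterCentralBond n) (fun c' => h.expChart (θ y c') * U₀ (iterCentralBond n c')) (σ y)) c *
        (Averaging.iter (fun j => blockAvg (P := P) (j := j) (expMeanLogSU (n := Fin N))) n U₀ c)⁻¹) = 0
    rw [hy, hfib (σ y) hyX, mul_inv_cancel, h.logChart_one]
  -- the read is `C^∞` at `(0, θ 0) = (0, 0)` (C2-a), with invertible pivot-derivative there (C2-b)
  have hRs : ContDiffAt ℝ ⊤ R (0, θ 0) := by rw [hθ0]; exact contDiffAt_pivotRead U₀ hU₀ σ hσc hσ0 hσs
  have hinv' : ((fderiv ℝ R (0, θ 0)).comp (ContinuousLinearMap.inr ℝ E (PBond P n → (specialUnitaryLogChart (Fin N)).lie))).IsInvertible := by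
    rw [hθ0]; exact hinv
  -- implicit-function assembly: `θ` is `C^∞` at `0`
  have hθs : ContDiffAt ℝ ⊤ θ 0 :=
    contDiffAt_of_implicitZero' (by simp) hRs hinv' hzero hθc
  -- the matrix field of `Φ (σ y)` is the ambient pivot field at `(y, θ y)` near `0`
  have hamb := contDiffAt_ambientPivotField (n := n) U₀ σ hσs
  have hpair : ContDiffAt ℝ ⊤ (fun y : E => (y, θ y)) 0 := contDiffAt_id.prodMk hθs
  have hcomp : ContDiffAt ℝ ⊤ (fun y : E => extend (iterCentralBond n)
      (fun c' => NormedSpace.exp (((θ y c' : (specialUnitaryLogChart (Fin N)).lie) : Matrix (Fin N) (Fin N) ℂ)) *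
        ((U₀ (iterCentralBond n c') : SU N) : Matrix (Fin N) (Fin N) ℂ)) (coeField (σ y))) 0 := by
    have hbase : ((fun y : E => (y, θ y)) 0) = ((0 : E), (0 : PBond P n → (specialUnitaryLogChart (Fin N)).lie)) := by
      show ((0 : E), θ 0) = _; rw [hθ0]
    have hamb' := hamb
    rw [← hbase] at hamb'
    exact hamb'.comp 0 hpair
  refine hcomp.congr_of_eventuallyEq ?_
  filter_upwards [hins] with y hy
  rw [← hy]
  exact coeField_pivotInsert U₀ (σ y) (θ y)

/-! ## §3 (H1): the Wilson action of the re-solved configuration is `C^∞` along the family -/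

/-- ★★★ **(H1) THE WILSON ACTION OF THE RE-SOLVED CONFIGURATION IS `C^∞` ALONG THE FAMILY** — §2 composed with the ambient Wilson action (§1).  With
`Φ := c.Φ (V, ·)`, `Xc := {z | c.jac (V, z) ≠ 0}`, `n := K − J`, `σ` = px21's tube, this is v8's displayed Peano row `ContDiffAt ℝ 2 (fun y => wilsonAction4 (c.Φ (V, σ y))) 0`
(at every order) MODULO the displayed (C2-b) row `hinv`. [cite: Balaban1985Variational, (5) p.278 and Thm 1 (8)–(10) p.279] [cite: Dieudonne1960, Ch. X §2 (10.2.1)] -/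
theorem contDiffAt_wilsonAction4_resolve {n : ℕ} (U₀ : GaugeField P 0 (SU N))
    (hU₀ : SmallBelow (fun j => blockAvg (P := P) (j := j) (expMeanLogSU (n := Fin N))) n U₀)
    (σ : E → GaugeField P 0 (SU N)) (hσc : Continuous σ) (hσ0 : σ 0 = U₀) (hσs : ContDiffAt ℝ ⊤ (fun y => coeField (σ y)) 0)
    (Φ : GaugeField P 0 (SU N) → GaugeField P 0 (SU N)) (Xc : Set (GaugeField P 0 (SU N)))
    (hoff : ∀ z ∈ Xc, ∀ b, (∀ c, iterCentralBond n c ≠ b) → Φ z b = z b)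
    (hfib : ∀ z ∈ Xc, Averaging.iter (fun j => blockAvg (P := P) (j := j) (expMeanLogSU (n := Fin N))) n (Φ z) =
      Averaging.iter (fun j => blockAvg (P := P) (j := j) (expMeanLogSU (n := Fin N))) n U₀)
    (hΦc : ContinuousWithinAt Φ Xc U₀) (hself : Φ U₀ = U₀) (hσX : ∀ᶠ y in 𝓝 0, σ y ∈ Xc)
    (hinv : ((fderiv ℝ (fun p : E × (PBond P n → (specialUnitaryLogChart (Fin N)).lie) => fun c : PBond P n =>
        (isChartRep_specialUnitaryGroup (n := Fin N)).logChart
          (Averaging.iter (fun j => blockAvg (P := P) (j := j) (expMeanLogSU (n := Fin N))) n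
              (extend (iterCentralBond n) (fun c' => (isChartRep_specialUnitaryGroup (n := Fin N)).expChart (p.2 c') * U₀ (iterCentralBond n c')) (σ p.1)) c *
            (Averaging.iter (fun j => blockAvg (P := P) (j := j) (expMeanLogSU (n := Fin N))) n U₀ c)⁻¹)) (0, 0)).comp
        (ContinuousLinearMap.inr ℝ E (PBond P n → (specialUnitaryLogChart (Fin N)).lie))).IsInvertible)
    (m : WithTop ℕ∞) :
    ContDiffAt ℝ m (fun y => wilsonAction4 (Φ (σ y))) 0 :=
  contDiffAt_wilsonAction4_of_coeField
    ((contDiffAt_coeField_resolve U₀ hU₀ σ hσc hσ0 hσs Φ Xc hoff hfib hΦc hself hσX hinv).of_le le_top)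

end Resolve

/-! ## §4 The raw (C2-b) row from the per-bond form: the pivot-derivative is block-diagonal over the coarse bonds -/

section Blocks

variable {ι : Type*} [Fintype ι]
variable {E F : Type*} [NormedAddCommGroup E] [NormedSpace ℝ E] [NormedAddCommGroup F] [NormedSpace ℝ F]

/-- **A DIAGONAL MAP HAS INVERTIBLE DERIVATIVE WHEN ITS BLOCKS DO**: if `G X i = φ i (X i)` with every `φ i` differentiable at `X₀ i` with invertible derivative, then
`fderiv G X₀` is invertible (its inverse is the diagonal of the block inverses). [folklore] -/
theorem isInvertible_fderiv_of_diagonal {φ : ι → F → F} {X₀ : ι → F} (hd : ∀ i, DifferentiableAt ℝ (φ i) (X₀ i))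
    (hinv : ∀ i, (fderiv ℝ (φ i) (X₀ i)).IsInvertible) :
    (fderiv ℝ (fun X : ι → F => fun i => φ i (X i)) X₀).IsInvertible := by
  choose e he using hinv
  have hG : HasFDerivAt (fun X : ι → F => fun i => φ i (X i))
      (ContinuousLinearMap.pi fun i => (fderiv ℝ (φ i) (X₀ i)).comp (ContinuousLinearMap.proj i)) X₀ :=
    hasFDerivAt_pi.2 fun i => ((hd i).hasFDerivAt.comp X₀ (ContinuousLinearMap.proj (R := ℝ) (φ := fun _ : ι => F) i).hasFDerivAt)
  rw [hG.fderiv]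
  refine ⟨ContinuousLinearEquiv.piCongrRight fun i => e i, ?_⟩
  ext X i
  have := ContinuousLinearMap.ext_iff.1 (he i) (X i)
  simpa using this

/-- ★ **THE RAW (C2-b) ROW FROM THE PER-BOND ROW.**  For a map `R : E × (ι → F) → (ι → F)` differentiable at `(0,0)` whose slice `R(0, ·)` is DIAGONAL with blocks
`φ i` (`R (0, X) i = φ i (X i)`; for the pivot-read this is ✓`pivotRead_base_eq_chainMap`), invertibility of every block derivative at `0` gives invertibility of
`fderiv R (0,0) ∘ inr` — the hypothesis `hinv` of §2. [cite: Dieudonne1960, Ch. X §2 (10.2.1) (bookkeeping)] -/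
theorem isInvertible_inr_of_blocks {R : E × (ι → F) → ι → F} (hR : DifferentiableAt ℝ R ((0 : E), (0 : ι → F)))
    {φ : ι → F → F} (hdiag : ∀ X i, R (0, X) i = φ i (X i)) (hd : ∀ i, DifferentiableAt ℝ (φ i) 0)
    (hinv : ∀ i, (fderiv ℝ (φ i) 0).IsInvertible) :
    ((fderiv ℝ R ((0 : E), (0 : ι → F))).comp (ContinuousLinearMap.inr ℝ E (ι → F))).IsInvertible := by
  -- `fderiv R (0,0) ∘ inr` is the derivative of the slice `X ↦ R (0, X)` at `0`
  have hslice : HasFDerivAt (fun X : ι → F => R ((0 : E), X))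
      ((fderiv ℝ R ((0 : E), (0 : ι → F))).comp (ContinuousLinearMap.inr ℝ E (ι → F))) 0 := by
    have h1 : HasFDerivAt (fun X : ι → F => ((0 : E), X)) (ContinuousLinearMap.inr ℝ E (ι → F)) (0 : ι → F) := hasFDerivAt_prodMk_right (0 : E) (0 : ι → F)
    exact hR.hasFDerivAt.comp (0 : ι → F) h1
  have hfun : (fun X : ι → F => R ((0 : E), X)) = fun X i => φ i (X i) := funext fun X => funext fun i => hdiag X i
  rw [← hslice.fderiv, hfun]
  exact isInvertible_fderiv_of_diagonal (X₀ := (0 : ι → F)) (fun i => hd i) (fun i => hinv i)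

end Blocks

end Summit.QuantumFields.YangMills.Theorems.FluctuationComparisonRegPrIntLS2BetaPivotResolveSmooth

end
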